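import Literature.Analysis.FunctionSpaces.SpinorWightmanPCTCovariance
import HarnessLib

/-!
# Spinor Wightman fields: covariant families of components and the covariance of their
`n`-point functions

Topic `Literature/Analysis/FunctionSpaces`, on the way to the PCT theorem
`Literature.Analysis.FunctionSpaces.pct_theorem` (Streater–Wightman (1964), §4-3, Thm. 4-7). The PCT
operator `Θ` maps field components to *adjoint* components, and the adjoint components
`φ_{(k,α)†}` of a species transform under the complex-conjugate representation `S̄^{(k)}`
(Streater–Wightman §3-1; `IsSpinorWightmanQFT.spinRep_cfield_adj`), so the PCT analysis has to be
run for products of members of arbitrary **covariant families**: a family is a tuple of component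
letters `idx : Fin m → W.Idx` with a common Bose/Fermi flag and a continuous matrix representation
`R` of `SL(2, ℂ)` under which it transforms (`SpinorWightmanData.CovFamily`). The species
multiplets (`speciesFamily`, `R = S^{(k)}`) and their adjoint multiplets (`adjFamily`, `R = S̄^{(k)}`)
are the two examples. For a sequence `Φ : Fin n → CovFamily W` this file repeats
`SpinorWightmanPCTCovariance` word for word:

* `spinRep_cmonomialVec_fam` (W2' for monomial vectors), `cWightmanFn_gSL_fam` (the transformation
  law (3-42) with `⊗ⱼ Rⱼ(A)`), `famDist` and its laws (`famDist_comp_poincareTestMulti_inl/inr`),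
  the relativized holomorphic function `famRelFn` on `𝒯ʳₙ` and its covariance `famRelFn_lorentz`.

## References

* R. F. Streater, A. S. Wightman, *PCT, Spin and Statistics, and All That* (1964; Princeton 2000),
  §3-1 eq. (3-4), §3-3 eqs. (3-42)–(3-44), Thm. 3-5. [StreaterWightman1964]
-/

noncomputable section

open Filter MeasureTheory Set ComplexConjugate Complex
open _root_.Topology
open scoped InnerProductSpace SchwartzMap MatrixGroups
open Literature.MathematicalPhysics Literature.MathematicalPhysics.QuantumLattice

namespace Literature.Analysis.FunctionSpaces

variable {κ : Type*}

/-! ### The complex-conjugate representation -/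

/-- The complex-conjugate matrix representation `A ↦ conj (S A)` (entrywise). [cite: StreaterWightman1964, §3-1] -/
def complexConjRep {m : ℕ} (S : SL(2, ℂ) →* Matrix (Fin m) (Fin m) ℂ) : SL(2, ℂ) →* Matrix (Fin m) (Fin m) ℂ :=
  ((starRingEnd ℂ).mapMatrix : Matrix (Fin m) (Fin m) ℂ →+* Matrix (Fin m) (Fin m) ℂ).toMonoidHom.comp S

/-- Entries of the conjugate representation. [folklore] -/
@[simp] theorem complexConjRep_apply {m : ℕ} (S : SL(2, ℂ) →* Matrix (Fin m) (Fin m) ℂ) (A : SL(2, ℂ)) (a b : Fin m) :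
    complexConjRep S A a b = conj (S A a b) := rfl

/-- The conjugate of a continuous representation is continuous. [folklore] -/
theorem continuous_complexConjRep {m : ℕ} {S : SL(2, ℂ) →* Matrix (Fin m) (Fin m) ℂ} (hS : Continuous S) : Continuous (complexConjRep S) :=
  Continuous.matrix_map hS continuous_conj

namespace SpinorWightmanData

variable (W : SpinorWightmanData κ)

/-- A **covariant family of field components**: `m` component letters `idx a ∈ W.Idx` with a common
Bose/Fermi flag, transforming under a continuous matrix representation `R` of `SL(2, ℂ)`:
`U(A) φ_{idx a}(f) U(A)⁻¹ = ∑_b R(A⁻¹)_{ab} φ_{idx b}(Λ(A) • f)` on `D` (Streater–Wightman (1964),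
§3-1, eq. (3-4), for a general finite-dimensional representation). [cite: StreaterWightman1964, §3-1 eq. (3-4)] -/
structure CovFamily where
  /-- the number of members -/
  m : ℕ
  /-- the component letters -/
  idx : Fin m → W.Idx
  /-- the matrix representation -/
  R : SL(2, ℂ) →* Matrix (Fin m) (Fin m) ℂ
  /-- continuity of the representation -/
  continuous_R : Continuous R
  /-- the common Bose/Fermi flag -/
  fermi : Bool
  /-- all members carry the flag -/
  isFermi_idx : ∀ a, W.isFermi (idx a).1 = fermi
  /-- the transformation law -/
  cov : ∀ (A : SL(2, ℂ)) (a : Fin m) (f : 𝓢(SpaceTime 3, ℂ)) (ψ : W.dom) (hψ : (W.spinRep A : W.H →L[ℂ] W.H) ψ ∈ W.dom),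
    (W.spinRep A : W.H →L[ℂ] W.H) (W.cfield (idx a) f ψ : W.H) =
      ∑ b, R A⁻¹ a b • (W.cfield (idx b) (poincareTest (SemidirectProduct.inr (spinCoverHom A) : PoincareGroup 3) f)
        ⟨(W.spinRep A : W.H →L[ℂ] W.H) ψ, hψ⟩ : W.H)

/-- The multi-indices of a sequence of families. [folklore] -/
abbrev MIdxF {n : ℕ} (Φ : Fin n → W.CovFamily) : Type := (j : Fin n) → Fin (Φ j).m

/-- Reindexing multi-indices along `rev`. [folklore] -/
def revMIdxF {n : ℕ} (Φ : Fin n → W.CovFamily) : W.MIdxF Φ ≃ W.MIdxF (fun j => Φ (Fin.rev j)) :=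
  (Equiv.piCongrLeft (fun j => Fin (Φ j).m) Fin.revPerm).symm

/-- `revMIdxF Φ α j = α (rev j)`. [folklore] -/
@[simp] theorem revMIdxF_apply {n : ℕ} (Φ : Fin n → W.CovFamily) (α : W.MIdxF Φ) (j : Fin n) :
    W.revMIdxF Φ α j = α (Fin.rev j) := rfl

end SpinorWightmanData

namespace IsSpinorWightmanQFT

open SpinorWightmanData

variable {W : SpinorWightmanData κ}

/-! ### The two examples -/

/-- The **species multiplet** `(φ_{k,α})_α` with `R = S^{(k)}`. [cite: StreaterWightman1964, §3-1 eq. (3-4)] -/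
def speciesFamily (hW : IsSpinorWightmanQFT W) (k : κ) : W.CovFamily where
  m := W.mult k
  idx a := ⟨k, a⟩
  R := W.S k
  continuous_R := hW.continuous_S k
  fermi := W.isFermi k
  isFermi_idx _ := rfl
  cov A a f ψ hψ := by
    rw [cfield_mk, hW.spinRep_field A k a f ψ]
    rfl

/-- The **adjoint multiplet** `(φ_{(k,α)†})_α` with `R = S̄^{(k)}`. [cite: StreaterWightman1964, §3-1] -/
def adjFamily (hW : IsSpinorWightmanQFT W) (k : κ) : W.CovFamily where
  m := W.mult k
  idx a := hW.adj ⟨k, a⟩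
  R := complexConjRep (W.S k)
  continuous_R := continuous_complexConjRep (hW.continuous_S k)
  fermi := W.isFermi k
  isFermi_idx a := hW.isFermi_adj ⟨k, a⟩
  cov A a f ψ hψ := by
    rw [hW.spinRep_cfield_adj A k a f ψ]
    rfl

/-- Unfolding `speciesFamily.m`. [folklore] -/
@[simp] theorem speciesFamily_m (hW : IsSpinorWightmanQFT W) (k : κ) : (hW.speciesFamily k).m = W.mult k := rfl
/-- Unfolding `speciesFamily.idx`. [folklore] -/
@[simp] theorem speciesFamily_idx (hW : IsSpinorWightmanQFT W) (k : κ) (a : Fin (W.mult k)) :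
    (hW.speciesFamily k).idx a = ⟨k, a⟩ := rfl
/-- Unfolding `speciesFamily.R`. [folklore] -/
@[simp] theorem speciesFamily_R (hW : IsSpinorWightmanQFT W) (k : κ) : (hW.speciesFamily k).R = W.S k := rfl
/-- Unfolding `speciesFamily.fermi`. [folklore] -/
@[simp] theorem speciesFamily_fermi (hW : IsSpinorWightmanQFT W) (k : κ) : (hW.speciesFamily k).fermi = W.isFermi k := rfl
/-- Unfolding `adjFamily.m`. [folklore] -/
@[simp] theorem adjFamily_m (hW : IsSpinorWightmanQFT W) (k : κ) : (hW.adjFamily k).m = W.mult k := rfl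
/-- Unfolding `adjFamily.idx`. [folklore] -/
@[simp] theorem adjFamily_idx (hW : IsSpinorWightmanQFT W) (k : κ) (a : Fin (W.mult k)) :
    (hW.adjFamily k).idx a = hW.adj ⟨k, a⟩ := rfl
/-- Unfolding `adjFamily.R`. [folklore] -/
@[simp] theorem adjFamily_R (hW : IsSpinorWightmanQFT W) (k : κ) : (hW.adjFamily k).R = complexConjRep (W.S k) := rfl
/-- Unfolding `adjFamily.fermi`. [folklore] -/
@[simp] theorem adjFamily_fermi (hW : IsSpinorWightmanQFT W) (k : κ) : (hW.adjFamily k).fermi = W.isFermi k := rfl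

/-! ### W2' for monomial vectors of family members -/

/-- **W2' for monomial vectors of family members**:
`U(A) φ_{α₀}(f₀) ⋯ φ_{α_{n−1}}(f_{n−1}) Ω = ∑_β ∏ⱼ Rⱼ(A⁻¹)_{αⱼβⱼ} φ_{β₀}(Λf₀) ⋯ Ω`. [cite: StreaterWightman1964, §3-1 eq. (3-4)] -/
theorem spinRep_cmonomialVec_fam (hW : IsSpinorWightmanQFT W) (A : SL(2, ℂ)) :
    ∀ {n : ℕ} (Φ : Fin n → W.CovFamily) (α : W.MIdxF Φ) (f : Fin n → 𝓢(SpaceTime 3, ℂ)),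
      (W.spinRep A : W.H →L[ℂ] W.H) (W.cmonomialVec (List.ofFn fun j => ((Φ j).idx (α j), f j)) : W.H) =
        ∑ β : W.MIdxF Φ, (∏ j, (Φ j).R A⁻¹ (α j) (β j)) •
          (W.cmonomialVec (List.ofFn fun j => ((Φ j).idx (β j), poincareTest (gSL A) (f j))) : W.H) := by
  intro n
  induction n with
  | zero =>
    intro Φ α f
    simp [List.ofFn_zero, hW.spinRep_vacuum A]
  | succ m ih =>
    intro Φ α f
    rw [List.ofFn_succ, cmonomialVec_cons]
    dsimp only
    rw [(Φ 0).cov A (α 0) (f 0) _ (hW.spinRep_dom A _ (W.cmonomialVec _).2)]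
    have htail := ih (fun j => Φ j.succ) (fun j => α j.succ) (fun j => f j.succ)
    have htail' : (⟨(W.spinRep A : W.H →L[ℂ] W.H) (W.cmonomialVec (List.ofFn fun j =>
        ((Φ j.succ).idx (α j.succ), f j.succ)) : W.H), hW.spinRep_dom A _ (W.cmonomialVec _).2⟩ : W.dom) =
        ∑ β : W.MIdxF (fun j => Φ j.succ), (∏ j, (Φ j.succ).R A⁻¹ (α j.succ) (β j)) •
          W.cmonomialVec (List.ofFn fun j => ((Φ j.succ).idx (β j), poincareTest (gSL A) (f j.succ))) := by
      apply Subtype.ext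
      simp only [Submodule.coe_sum, Submodule.coe_smul]
      exact htail
    simp_rw [htail', map_sum, map_smul, Submodule.coe_sum, Submodule.coe_smul, Finset.smul_sum, smul_smul]
    symm
    rw [← (Fin.consEquiv fun j => Fin (Φ j).m).sum_comp, Fintype.sum_prod_type]
    refine Finset.sum_congr rfl fun β₀ _ => Finset.sum_congr rfl fun β' _ => ?_
    simp only [Fin.consEquiv_apply]
    rw [Fin.prod_univ_succ]
    simp only [Fin.cons_zero, Fin.cons_succ]
    congr 1
    rw [List.ofFn_succ, cmonomialVec_cons]
    simp only [Fin.cons_zero, Fin.cons_succ]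

/-! ### The transformation law of the `n`-point functions of family members -/

/-- **First form**: `𝒲_α(f) = ∑_β ∏ⱼ Rⱼ(A⁻¹)_{αⱼβⱼ} 𝒲_β(Λf)`. [cite: StreaterWightman1964, §3-3 eq. (3-42)] -/
theorem cWightmanFn_eq_sum_gSL_fam (hW : IsSpinorWightmanQFT W) (A : SL(2, ℂ)) {n : ℕ} (Φ : Fin n → W.CovFamily)
    (α : W.MIdxF Φ) (f : Fin n → 𝓢(SpaceTime 3, ℂ)) :
    W.cWightmanFn n (fun j => (Φ j).idx (α j)) f =
      ∑ β : W.MIdxF Φ, (∏ j, (Φ j).R A⁻¹ (α j) (β j)) *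
        W.cWightmanFn n (fun j => (Φ j).idx (β j)) (fun j => poincareTest (gSL A) (f j)) := by
  rw [SpinorWightmanData.cWightmanFn, ← Unitary.inner_map_map (W.spinRep A), hW.spinRep_vacuum A,
    hW.spinRep_cmonomialVec_fam A Φ α f, inner_sum]
  refine Finset.sum_congr rfl fun β _ => ?_
  rw [inner_smul_right, SpinorWightmanData.cWightmanFn]

/-- **The transformation law of the `n`-point functions of family members** (S–W (3-42)):
`𝒲_α(Λf) = ∑_β ∏ⱼ Rⱼ(A)_{αⱼβⱼ} 𝒲_β(f)`. [cite: StreaterWightman1964, §3-3 eq. (3-42)] -/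
theorem cWightmanFn_gSL_fam (hW : IsSpinorWightmanQFT W) (A : SL(2, ℂ)) {n : ℕ} (Φ : Fin n → W.CovFamily)
    (α : W.MIdxF Φ) (f : Fin n → 𝓢(SpaceTime 3, ℂ)) :
    W.cWightmanFn n (fun j => (Φ j).idx (α j)) (fun j => poincareTest (gSL A) (f j)) =
      ∑ β : W.MIdxF Φ, (∏ j, (Φ j).R A (α j) (β j)) * W.cWightmanFn n (fun j => (Φ j).idx (β j)) f := by
  have h := hW.cWightmanFn_eq_sum_gSL_fam A⁻¹ Φ α (fun j => poincareTest (gSL A) (f j))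
  simp only [inv_inv, poincareTest_gSL_inv_apply] at h
  exact h

/-! ### The `n`-point distributions of a sequence of families -/

/-- The `n`-point **distribution of the members `(Φⱼ).idx αⱼ`**. [cite: StreaterWightman1964, §3-3 eq. (3-19)] -/
def famDist (hW : IsSpinorWightmanQFT W) {n : ℕ} (Φ : Fin n → W.CovFamily) (α : W.MIdxF Φ) :
    𝓢((Fin n → SpaceTime 3), ℂ) →L[ℂ] ℂ :=
  hW.vectorDistribution W.vacuum n fun j => (Φ j).idx (α j)

/-- On tensor products the distribution is the `n`-point function. [cite: StreaterWightman1964, §3-3 eq. (3-19)] -/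
theorem famDist_apply_of_isTensorOf (hW : IsSpinorWightmanQFT W) {n : ℕ} (Φ : Fin n → W.CovFamily) (α : W.MIdxF Φ)
    {G : 𝓢((Fin n → SpaceTime 3), ℂ)} {g : Fin n → 𝓢(SpaceTime 3, ℂ)} (hG : IsTensorOf G g) :
    hW.famDist Φ α G = W.cWightmanFn n (fun j => (Φ j).idx (α j)) g := by
  rw [famDist, (hW.isSpinorVectorDistributionOf_vectorDistribution W.vacuum n _).apply_eq_cWightmanFn hG]

/-- **The transformation law as an identity of distributions**. [cite: StreaterWightman1964, §3-3 eq. (3-42)] -/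
theorem famDist_comp_poincareTestMulti_inr (hW : IsSpinorWightmanQFT W) {n : ℕ} (Φ : Fin n → W.CovFamily) (α : W.MIdxF Φ)
    (A : SL(2, ℂ)) :
    (hW.famDist Φ α).comp (poincareTestMulti n (SemidirectProduct.inr (spinCoverHom A))) =
      ∑ β : W.MIdxF Φ, (∏ j, (Φ j).R A (α j) (β j)) • hW.famDist Φ β := by
  refine SchwingerFamily.ext_of_denseSpan denseSpan_tensorProducts_holds fun g G hG => ?_
  rw [ContinuousLinearMap.comp_apply, hW.famDist_apply_of_isTensorOf Φ α (hG.poincareTestMulti _)]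
  change W.cWightmanFn n _ (fun j => poincareTest (gSL A) (ofRealTest (g j))) = _
  rw [hW.cWightmanFn_gSL_fam A Φ α, sum_apply]
  refine Finset.sum_congr rfl fun β _ => ?_
  rw [smul_apply, hW.famDist_apply_of_isTensorOf Φ β hG, smul_eq_mul]

/-- **Translation invariance of the `n`-point functions of letters**: `𝒲(f(· − a)) = 𝒲(f)`.
[cite: StreaterWightman1964, §3-3 eq. (3-21)] -/
theorem cWightmanFn_translate (hW : IsSpinorWightmanQFT W) (a : SpaceTime 3) {n : ℕ} (i : Fin n → W.Idx)
    (f : Fin n → 𝓢(SpaceTime 3, ℂ)) :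
    W.cWightmanFn n i (fun j => poincareTest (SemidirectProduct.inl (Multiplicative.ofAdd a) : PoincareGroup 3) (f j)) =
      W.cWightmanFn n i f := by
  have hΩ : W.transl (Multiplicative.ofAdd a) W.vacuum = W.vacuum := by
    have h := hW.U_vacuum a 1
    rwa [W.U_one_right] at h
  have hU := ContinuousLinearMap.inner_map_map_of_mem_unitary (W.transl.apply_mem_unitary (Multiplicative.ofAdd a))
    W.vacuum (W.cmonomialVec (List.ofFn fun j => (i j, f j)) : W.H)
  rw [hΩ, hW.transl_cmonomialVec a, List.map_ofFn] at hU
  rw [SpinorWightmanData.cWightmanFn, SpinorWightmanData.cWightmanFn]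
  exact hU

/-- **Translation invariance as an identity of distributions**. [cite: StreaterWightman1964, §3-3 eq. (3-21)] -/
theorem famDist_comp_poincareTestMulti_inl (hW : IsSpinorWightmanQFT W) {n : ℕ} (Φ : Fin n → W.CovFamily) (α : W.MIdxF Φ)
    (a : SpaceTime 3) :
    (hW.famDist Φ α).comp (poincareTestMulti n (SemidirectProduct.inl (Multiplicative.ofAdd a))) = hW.famDist Φ α := by
  refine SchwingerFamily.ext_of_denseSpan denseSpan_tensorProducts_holds fun g G hG => ?_
  rw [ContinuousLinearMap.comp_apply, hW.famDist_apply_of_isTensorOf Φ α (hG.poincareTestMulti _),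
    hW.cWightmanFn_translate a _, hW.famDist_apply_of_isTensorOf Φ α hG]

/-! ### The holomorphic `n`-point function of a sequence of families on the relative tube -/

/-- The chosen holomorphic extension of `famDist Φ α` to `𝒯ₙ`. [cite: StreaterWightman1964, Thm 3-5] -/
def famTubeFn (hW : IsSpinorWightmanQFT W) {n : ℕ} (Φ : Fin n → W.CovFamily) (α : W.MIdxF Φ) :
    (Fin n → Fin (3 + 1) → ℂ) → ℂ :=
  (hW.exists_vectorTubeFunction W.vacuum n fun j => (Φ j).idx (α j)).choose

/-- `famTubeFn` is holomorphic on `𝒯ₙ`. [cite: StreaterWightman1964, Thm 3-5] -/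
theorem differentiableOn_famTubeFn (hW : IsSpinorWightmanQFT W) {n : ℕ} (Φ : Fin n → W.CovFamily) (α : W.MIdxF Φ) :
    DifferentiableOn ℂ (hW.famTubeFn Φ α) (forwardTube 3 n) :=
  (hW.exists_vectorTubeFunction W.vacuum n fun j => (Φ j).idx (α j)).choose_spec.1

/-- `famTubeFn` has the boundary value `famDist`. [cite: StreaterWightman1964, Thm 3-5] -/
theorem hasDistributionalBoundaryValue_famTubeFn (hW : IsSpinorWightmanQFT W) {n : ℕ} (Φ : Fin n → W.CovFamily)
    (α : W.MIdxF Φ) : HasDistributionalBoundaryValue (hW.famTubeFn Φ α) (hW.famDist Φ α) :=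
  (hW.exists_vectorTubeFunction W.vacuum n fun j => (Φ j).idx (α j)).choose_spec.2

/-- Real translation invariance of `famTubeFn` on `𝒯ₙ`. [cite: StreaterWightman1964, Thm 3-5] -/
theorem famTubeFn_add_real (hW : IsSpinorWightmanQFT W) {n : ℕ} (Φ : Fin n → W.CovFamily) (α : W.MIdxF Φ)
    (a : SpaceTime 3) {z : Fin n → Fin (3 + 1) → ℂ} (hz : z ∈ forwardTube 3 n) :
    hW.famTubeFn Φ α (fun j => z j + complexifyPoint a) = hW.famTubeFn Φ α z :=
  eqOn_add_real_of_bv (hW.differentiableOn_famTubeFn Φ α) (hW.hasDistributionalBoundaryValue_famTubeFn Φ α)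
    (hW.famDist_comp_poincareTestMulti_inl Φ α) a hz

/-- **The holomorphic `n`-point function of a sequence of families on the relative tube**
(relativization of the chosen tube functions). [cite: StreaterWightman1964, Thm 3-5] -/
def famRelFn (hW : IsSpinorWightmanQFT W) {n : ℕ} (Φ : Fin n → W.CovFamily) (z : Fin n → Fin (3 + 1) → ℂ) : W.MIdxF Φ → ℂ :=
  fun α => relativize (hW.famTubeFn Φ α) z

/-- Components of `famRelFn`. [folklore] -/
theorem famRelFn_apply (hW : IsSpinorWightmanQFT W) {n : ℕ} (Φ : Fin n → W.CovFamily) (z : Fin n → Fin (3 + 1) → ℂ) (α : W.MIdxF Φ) :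
    hW.famRelFn Φ z α = relativize (hW.famTubeFn Φ α) z := rfl

/-- `famRelFn` is holomorphic on `𝒯ʳₙ`. [cite: StreaterWightman1964, Thm 3-5] -/
theorem differentiableOn_famRelFn (hW : IsSpinorWightmanQFT W) {n : ℕ} (Φ : Fin n → W.CovFamily) :
    DifferentiableOn ℂ (hW.famRelFn Φ) (QuantumFieldTheory.relForwardTube 3 n) :=
  differentiableOn_pi.2 fun α => differentiableOn_relativize (hW.differentiableOn_famTubeFn Φ α)

/-- Each component of `famRelFn` has the boundary value `famDist`. [cite: StreaterWightman1964, Thm 3-5] -/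
theorem hasDistributionalBoundaryValue_famRelFn (hW : IsSpinorWightmanQFT W) {n : ℕ} (Φ : Fin n → W.CovFamily) (α : W.MIdxF Φ) :
    HasDistributionalBoundaryValue (fun z => hW.famRelFn Φ z α) (hW.famDist Φ α) :=
  (hW.hasDistributionalBoundaryValue_famTubeFn Φ α).relativize (hW.differentiableOn_famTubeFn Φ α)
    (fun a _ hz => hW.famTubeFn_add_real Φ α a hz)

/-- **`famRelFn` is invariant under all common complex translations.** [cite: StreaterWightman1964, Thm 3-5] -/
theorem famRelFn_add_const (hW : IsSpinorWightmanQFT W) {n : ℕ} (Φ : Fin n → W.CovFamily) (z : Fin n → Fin (3 + 1) → ℂ)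
    (c : Fin (3 + 1) → ℂ) : hW.famRelFn Φ (fun j => z j + c) = hW.famRelFn Φ z := by
  funext α
  exact relativize_add_const _ z c

/-- On `𝒯ₙ` the relativized function is the chosen tube function. [folklore] -/
theorem famRelFn_apply_eq_famTubeFn (hW : IsSpinorWightmanQFT W) {n : ℕ} (Φ : Fin n → W.CovFamily) {z : Fin n → Fin (3 + 1) → ℂ}
    (hz : z ∈ forwardTube 3 n) (α : W.MIdxF Φ) : hW.famRelFn Φ z α = hW.famTubeFn Φ α z :=
  relativize_eq_self (hW.differentiableOn_famTubeFn Φ α) (fun a _ hw => hW.famTubeFn_add_real Φ α a hw) hz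

/-- **Covariance of the holomorphic `n`-point function of a sequence of families**:
`𝒲(Λ(A) z)_α = ∑_β ∏ⱼ Rⱼ(A)_{αⱼβⱼ} 𝒲(z)_β` on `𝒯ʳₙ`. [cite: StreaterWightman1964, Thm 3-5 eq. (3-44)] -/
theorem famRelFn_lorentz (hW : IsSpinorWightmanQFT W) {n : ℕ} (Φ : Fin n → W.CovFamily) (A : SL(2, ℂ))
    {z : Fin n → Fin (3 + 1) → ℂ} (hz : z ∈ QuantumFieldTheory.relForwardTube 3 n) (α : W.MIdxF Φ) :
    hW.famRelFn Φ (fun j => lorentzActC (spinLorentz A) (z j)) α =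
      ∑ β : W.MIdxF Φ, (∏ j, (Φ j).R A (α j) (β j)) * hW.famRelFn Φ z β :=
  apply_lorentz_eq_sum_of_bv (F := hW.famRelFn Φ) (hW.differentiableOn_famRelFn Φ)
    (hW.hasDistributionalBoundaryValue_famRelFn Φ) (spinCoverHom A)
    (fun α β => ∏ j, (Φ j).R A (α j) (β j)) (fun α => hW.famDist_comp_poincareTestMulti_inr Φ α A) hz α

end IsSpinorWightmanQFT

end Literature.Analysis.FunctionSpaces
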